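import Summits.CriticalPhenomena.SAWScalingLimit.Theses.SAWLoopFugacityFlow
import Summits.CriticalPhenomena.SAWScalingLimit.Theorems.AvoidanceLimit.Negative.AvoidanceLimitWitnessDomains
import Summits.CriticalPhenomena.SAWScalingLimit.Theorems.AvoidanceLimit.Negative.AvoidanceLimitFalseWithoutChordal
import Summits.CriticalPhenomena.SAWScalingLimit.Theorems.AvoidanceLimit.Negative.AvoidanceLimitFalseWithoutReachable
import Summits.CriticalPhenomena.SAWScalingLimit.Theorems.AvoidanceLimit.Negative.AvoidanceLimitRestrictionData
import Literature.Probability.RandomPlanarGeometry.SupercriticalSAWPolygons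

/-!
# Line `saw-corner-germ` — skeleton for the crux `AvoidanceLimit` (stmt-CriticalPhenomena-10649)

Route `SAWLoopFugacityFlow` (rank-2 crux): for every Dobrushin domain `(D; a, b)`, hull subdomain
`D'`, endpoint approximation, chordal uniformizer `φ`, pulled-back hull `A` and restriction data
`(Φ, d = Φ'_A(0))`, the critical `δℤ²`-SAW avoidance probability `P_δ(range γ ⊆ closure D')`
tends to `d^(5/8)`.

Idea card `Ideas/saw-corner-germ.md` (crux-ideate r1, ideator 1; triage r1: 3 × pass, merge with
`polymer-end-linear-response`): the route's mechanism reaches the SAW as the `n = 0` END of a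
loop-fugacity continuation, and the route itself lists the commutation `n → 0⁺` / `δ → 0⁺` at
that corner under NOT DECOMPOSED YET.  The lever is LINEAR RESPONSE AT THE CORNER: the first
`n`-derivative of the doubly normalised two-leg ratio `R_δ(n; D, D')` at `n = 0` is a
differenced, length-compensated contact-polygon expectation under `SAW.law` itself, so δ-uniform
regularity of `n ↦ R_δ(n)` at the corner is a moment problem for the critical SAW; and
(triage r1-1, sharpen 2) for the crux a δ-UNIFORM LIPSCHITZ BOUND ON A REAL INTERVAL `[0, n₀]`
suffices — no complex neighbourhood of `0` (the fragile corner of the route's `FugacityAnalyticity`)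
is needed.

## What this file types (all over existing declarations; the family is the STRICTLY DILUTE one,
`w ≡ 0`, as the triage asked us to say explicitly)

* `loopZ G S n x` — the strictly dilute loop gas on a graph `G` avoiding a vertex set `S`: finite
  families of pairwise vertex-disjoint self-avoiding polygons (`SAW.IsPolygon`) missing `S`, weight
  `n^{#polygons} x^{#edges}`; `twoLegZ Ω δ a b n x = Σ_γ x^{|γ|} loopZ (Ω_δ ∖ γ)` over
  `SAW.DomainSAW Ω δ a b`; `vacZ`; the doubly normalised ratio
  `ratio Ω Ω' δ a b n x = [Z(Ω';a,b)/Z(Ω')] / [Z(Ω;a,b)/Z(Ω)]`.  At `n = 0` the gas is empty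
  (`loopZ_zero_left : loopZ G S 0 x = 1`) and the ratio is the plain SAW generating-function ratio
  (`ratio_zero_left`).  No osculations and no crossings occur: walk and polygons are vertex-disjoint
  and each is self-avoiding, so this is the `(n, w) = (n, 0)` path through the SAW corner, NOT the
  route's diagonal `w = n/2` (triage r1-1/2/3 correction (i) is moot on this path: the `O(n)` term
  has no single-osculation strand).  It is the path on which the card's `CornerGerm`
  (SketchIdeator1) and ideator 3's `LinearResponseLaw` are typed, and the only one typeable today
  (the route's `DiluteLoopModel` with non-crossing pairings is a pending definition request).
  FAMILY-AGNOSTIC COMPOSITION: at `n = 0` every path through the corner is the same `x_c`-SAW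
  (no loops, no degree-4 vertices), and `AvoidanceLimit_of` touches `n > 0` only through stubs 3–5;
  when `DiluteLoopModel` lands the lead may re-instantiate stubs 3–5 verbatim with `ratio` replaced
  by the diagonal ratio and keep stubs 1–2 and the composition unchanged.  On THIS path stubs 4–5
  are the route's `FugacityAnalyticity` / `IsingWindow` outputs transported from the diagonal at
  fixed small `n > 0` (one osculation-irrelevance / `w`-analyticity step: the card's L-path,
  `x₄ = 35/12 > 2`), or reached from the sibling anchor `symplectic-fermion-anchor` along `(n, t)`.
* `critLine n` — the critical fugacity of the family, CANONICALLY: the supremum of the initial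
  interval of fugacities `x` at which the normalised two-leg ratio across the reference box
  `refBox L = (−L, L)²` (mesh 1, endpoints `(1−L, 0)`, `(L−1, 0)`) is massive (decays like
  `e^{−mL}`).  `stub_criticalLineAtZero` says `critLine 0 = x_c = 1/μ`.
* `lineRatio D D' a b δ n = ratio D D' δ (a δ) (b δ) n (critLine n)` — `R_δ(n; D, D')` ALONG the
  critical line; `dilExp n = 1 − (3/4π)·arccos(−n/2)` — the dilute Coulomb-gas boundary exponent
  `b = (6−κ)/(2κ)`, `n = −2cos(4π/κ)` (`dilExp_zero : dilExp 0 = 5/8`; `dilExp 1 = 1/2`).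

## The five stubs and the composition (`AvoidanceLimit_of`, kernel-checked, no `sorry`)

1. `stub_criticalLineAtZero`   — `critLine 0 = SAW.criticalFugacity` (pure SAW; M–L).
2. `stub_cornerIdentification` — `P_δ(range ⊆ cl D') − Z_{x_c}(Ω'_δ;a,b)/Z_{x_c}(Ω_δ;a,b) → 0`
   (lattice bookkeeping of the corner: largest components, `a_δ, b_δ ∈ Ω'_δ` eventually, law is a
   probability measure by reachability, boundary-touching walks negligible; M–L).
3. `stub_cornerLipschitz`      — THE LEVER: `∃ n₀ > 0, C, ∀ᶠ δ, ∀ n ∈ [0,n₀],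
   |R_δ(n) − R_δ(0)| ≤ C·n` (δ-uniform Lipschitz bound at the corner; its `n = 0` shadow is the
   card's CornerFinite / ideator 3's `LinearResponseFinite`; L–XL).
4. `stub_positiveFugacityLimits` — for each small `n > 0`, `lim_{δ→0⁺} R_δ(n)` EXISTS (the
   convergence half of the route's `FugacityAnalyticity`, Vitali from δ-uniform bounds; XL).
5. `stub_coulombGasValues`     — if those limits `v(n)` exist on `(0, n₀]` then eventually near
   `0⁺`, `v(n) = d^{dilExp n}` (the closed form the route's `IsingWindow` + identity theorem
   transport to positive `n`; uses ALL the conformal data; XL).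

`AvoidanceLimit_of`: (5) + continuity of `dilExp` at `0` (`arccos`) and of `t ↦ d^t` at `5/8 ≠ 0`
give `v(n) → d^(5/8)` as `n → 0⁺`; with (4) and (3) an `ε/3`-argument gives `R_δ(0) → d^(5/8)`
as `δ → 0⁺` (the limits commute at the corner); (1) identifies `R_δ(0)` with the `x_c`-SAW
generating-function ratio, (2) with the avoidance probability, and `P_δ ≤ 1`
(`map_law_apply_le_one`, re-proved inline: the landed `Negative/AvoidanceLimitExponentRigidity` is
not yet built on the farm) converts to `ENNReal`.

## Disproof used (Disproof.lean cycles 1–2, read 2026-08-16T02:25Z, + landed `Theorems/AvoidanceLimit/Negative/*`)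

* `avoidanceLimit_false_without_chordal / _normalisation / _deriv / _hullEq` — HONOURED at
  `stub_coulombGasValues`, the only stub that sees `d`: it keeps `D.IsChordalUniformizing φ`,
  `A = closure (ℍ ∖ φ⁻¹ D')`, `IsRestrictionMap A Φ` and `HasRestrictionDeriv A Φ d` verbatim
  (the value `d^{b(n)}` is pinned only by THE normalised map of THE pulled-back hull).
* `avoidanceLimit_false_without_reachable` — HONOURED at `stub_cornerIdentification`: the
  identification of `P_δ` with a ratio of generating functions needs `SAW.law` to be a probability
  measure, i.e. `IsEndpointApprox.reachable`; with the far-site witness both sides are `0` and the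
  stub's difference is `0`, but then `lineRatio ≡ 0` and stub 5 (value `d^{b(n)} > 0`) fails —
  consistent: the witness violates `IsEndpointApprox`.
* `avoidanceLimit_false_without_ball_and_pt` (cycle 2) — HONOURED: stubs 2–5 keep `hpt ∧ hball`.
* `avoidanceLimitExp_unique` / `avoidanceLimit_not_exp` (cycle 2, landed, exponent rigidity) —
  CONSISTENT and USED AS A DESIGN CONSTRAINT: the skeleton must single out `5/8`; it does so only in
  stub 5 (`dilExp`, continued from the window) — stubs 1–4 are value-free, as the disprover's moral
  demands ("no exponent-blind argument can close it").
* cycle 2 §6 (closed event vs open subdomain: `{range ⊆ closure D'}` = walks of the closed-edge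
  subgraph, differing from `Ω'_δ`-walks only by vertices ON `∂D' ∩ D`; "a boundary row carries no
  entropic gain at `x_c`") — this is exactly the content of `stub_cornerIdentification`; the
  disprover's verdict "the planner's expected `o(1)` is right" supports it.
* decorative `hpt`: carried verbatim, unused.  Near-miss `WithoutBall`: every stub keeps the ε-ball
  clause (stub 2 needs it to put `a_δ, b_δ` in `Ω'_δ`; stub 3's finiteness needs the endpoint
  factors to cancel between `D` and `D'`, triage r1-3 (ii); cycle 2 §9: Kennedy–Lawler factors are
  the same for `D` and `D'` and cancel in the ratio).
* No `-- Targets` stub kill in Disproof.lean applies; no landed Negative lemma refutes an instance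
  of any stub (the Negative lemmas concern the crux's frame, which stubs 2–5 copy verbatim).
-/

noncomputable section

open Set Filter Topology MeasureTheory
open scoped ENNReal
open Literature.Probability.RandomPlanarGeometry Literature.Probability.LatticeModels
open Summit.CriticalPhenomena.SAWScalingLimit.Theses.SAWLoopFugacityFlow (AvoidanceLimit)
open Summit.CriticalPhenomena.SAWScalingLimit.Theorems.AvoidanceLimit.Negative

namespace Summit.CriticalPhenomena.SAWScalingLimit.Cruxes.AvoidanceLimit.SawCornerGerm

/-! ### The strictly dilute loop-dressed SAW (`w ≡ 0` family through the SAW corner) -/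

/-- The vertices covered by a finite edge set. -/
def edgeVerts (E : Finset (Sym2 (Site 2))) : Set (Site 2) := {v | ∃ e ∈ E, v ∈ e}

/-- A configuration of the STRICTLY DILUTE loop gas on `G` avoiding the vertex set `S`: a finite
family of self-avoiding polygons of `G` (`SAW.IsPolygon`, Madras–Slade Def. 3.2.1), pairwise
vertex-disjoint, none of which meets `S`.  No crossings, no osculations. -/
def IsLoopConfig (G : SimpleGraph (Site 2)) (S : Set (Site 2))
    (F : Finset (Finset (Sym2 (Site 2)))) : Prop :=
  (∀ P ∈ F, SAW.IsPolygon G P) ∧ (∀ P ∈ F, Disjoint (edgeVerts P) S) ∧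
    (F : Set (Finset (Sym2 (Site 2)))).Pairwise fun P Q => Disjoint (edgeVerts P) (edgeVerts Q)

open Classical in
/-- Partition function of the strictly dilute loop gas on `G` avoiding `S`:
`Σ_F n^{#F} x^{Σ_{P ∈ F} |P|}` over loop configurations (a finite sum when `G` has finitely many
edges, e.g. `G = Ω_δ` for bounded `Ω`, `δ > 0`; junk `0` if not summable). -/
def loopZ (G : SimpleGraph (Site 2)) (S : Set (Site 2)) (n x : ℝ) : ℝ :=
  ∑' F : Finset (Finset (Sym2 (Site 2))),
    if IsLoopConfig G S F then n ^ F.card * x ^ (∑ P ∈ F, P.card) else 0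

/-- Two-leg partition function `Z_{n,x}(Ω_δ; a, b) = Σ_γ x^{|γ|} · loopZ (Ω_δ ∖ γ)`: a self-avoiding
walk of `Ω_δ` from `a` to `b` dressed by the loop gas in the complement of its vertices. -/
def twoLegZ (Ω : Set ℂ) (δ : ℝ) (a b : Site 2) (n x : ℝ) : ℝ :=
  ∑' γ : SAW.DomainSAW Ω δ a b,
    x ^ γ.length * loopZ (discreteDomainGraph Ω δ) {v | v ∈ γ.walk.support} n x

/-- Vacuum partition function `Z_{n,x}(Ω_δ)` (loops only). -/
def vacZ (Ω : Set ℂ) (δ : ℝ) (n x : ℝ) : ℝ := loopZ (discreteDomainGraph Ω δ) ∅ n x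

/-- The doubly normalised two-leg boundary ratio of the route,
`R_δ(n, x; Ω, Ω') = [Z(Ω'_δ; a,b)/Z(Ω'_δ)] / [Z(Ω_δ; a,b)/Z(Ω_δ)]`. -/
def ratio (Ω Ω' : Set ℂ) (δ : ℝ) (a b : Site 2) (n x : ℝ) : ℝ :=
  (twoLegZ Ω' δ a b n x / vacZ Ω' δ n x) / (twoLegZ Ω δ a b n x / vacZ Ω δ n x)

/-! ### The critical line of the family, canonically -/

/-- Reference box `(−L, L)²` (discretised at mesh `1`: sites `{1−L, …, L−1}²`). -/
def refBox (L : ℕ) : Set ℂ := symRect L L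

/-- Left mid-side site `(1 − L, 0)` of the reference box. -/
def leftSite (L : ℕ) : Site 2 := ![1 - (L : ℤ), 0]

/-- Right mid-side site `(L − 1, 0)` of the reference box. -/
def rightSite (L : ℕ) : Site 2 := ![(L : ℤ) - 1, 0]

/-- Normalised two-leg function across the reference box at parameters `(n, x)`. -/
def boxRatio (L : ℕ) (n x : ℝ) : ℝ :=
  twoLegZ (refBox L) 1 (leftSite L) (rightSite L) n x / vacZ (refBox L) 1 n x

/-- `(n, x)` is MASSIVE: the box two-leg function decays exponentially in the box size. -/
def IsMassive (n x : ℝ) : Prop :=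
  ∃ m : ℝ, 0 < m ∧ ∀ᶠ L : ℕ in atTop, boxRatio L n x ≤ Real.exp (-(m * L))

/-- The critical fugacity `x_c(n)` of the strictly dilute family: the right end of the initial
interval of massive fugacities (for `n ≥ 0` the weights are non-negative and `x = 0` is massive). -/
def critLine (n : ℝ) : ℝ := sSup {x : ℝ | 0 ≤ x ∧ ∀ y ∈ Set.Icc 0 x, IsMassive n y}

/-- `R_δ(n; D, D')` ALONG THE CRITICAL LINE, for the crux's data (endpoints `a δ`, `b δ`). -/
def lineRatio (D D' : DobrushinDomain) (a b : ℝ → Site 2) (δ n : ℝ) : ℝ :=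
  ratio D.carrier D'.carrier δ (a δ) (b δ) n (critLine n)

/-- The `x_c`-SAW generating-function ratio `Z_{x_c}(Ω'_δ; a_δ, b_δ)/Z_{x_c}(Ω_δ; a_δ, b_δ)`. -/
def sawRatio (D D' : DobrushinDomain) (a b : ℝ → Site 2) (δ : ℝ) : ℝ :=
  (∑' γ : SAW.DomainSAW D'.carrier δ (a δ) (b δ), SAW.criticalFugacity ^ γ.length) /
    ∑' γ : SAW.DomainSAW D.carrier δ (a δ) (b δ), SAW.criticalFugacity ^ γ.length

/-- The crux's avoidance probability `P_δ(range γ_δ ⊆ closure D')` (pushed-forward `SAW.law`). -/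
def avoidProb (D D' : DobrushinDomain) (a b : ℝ → Site 2) (δ : ℝ) : ℝ≥0∞ :=
  ((SAW.law D.carrier δ (a δ) (b δ)).map (fun γ => γ.curve))
    (CurveClass.rangeSubset (closure D'.carrier))

/-- The dilute Coulomb-gas boundary one-leg exponent as a function of the loop fugacity:
`b = (6 − κ)/(2κ)` with `n = −2cos(4π/κ)`, `κ ∈ [8/3, 4]`, i.e. `b(n) = 1 − (3/4π)·arccos(−n/2)`
(`b(0) = 5/8`, `b(1) = 1/2`; Nienhuis 1982, Cardy 2005 §5.3). -/
def dilExp (n : ℝ) : ℝ := 1 - 3 / (4 * Real.pi) * Real.arccos (-n / 2)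

/-! ### Elementary identities at the corner `n = 0` (proved) -/

theorem isLoopConfig_empty (G : SimpleGraph (Site 2)) (S : Set (Site 2)) : IsLoopConfig G S ∅ := by
  refine ⟨?_, ?_, ?_⟩
  · intro P hP; exact absurd hP (Finset.notMem_empty P)
  · intro P hP; exact absurd hP (Finset.notMem_empty P)
  · simp

/-- At `n = 0` the loop gas is empty: only the empty family survives (`0⁰ = 1`). -/
theorem loopZ_zero_left (G : SimpleGraph (Site 2)) (S : Set (Site 2)) (x : ℝ) :
    loopZ G S 0 x = 1 := by
  classical
  unfold loopZ
  rw [tsum_eq_single ∅]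
  · simp [isLoopConfig_empty]
  · intro F hF
    split_ifs with h
    · rw [zero_pow (Finset.card_ne_zero.2 (Finset.nonempty_iff_ne_empty.2 hF)), zero_mul]
    · rfl

/-- At `n = 0` the two-leg function is the plain SAW generating function `Σ_γ x^{|γ|}`. -/
theorem twoLegZ_zero_left (Ω : Set ℂ) (δ : ℝ) (a b : Site 2) (x : ℝ) :
    twoLegZ Ω δ a b 0 x = ∑' γ : SAW.DomainSAW Ω δ a b, x ^ γ.length := by
  simp [twoLegZ, loopZ_zero_left]

theorem vacZ_zero_left (Ω : Set ℂ) (δ : ℝ) (x : ℝ) : vacZ Ω δ 0 x = 1 :=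
  loopZ_zero_left _ _ _

/-- At `n = 0` the doubly normalised ratio is the ratio of SAW generating functions. -/
theorem ratio_zero_left (Ω Ω' : Set ℂ) (δ : ℝ) (a b : Site 2) (x : ℝ) :
    ratio Ω Ω' δ a b 0 x =
      (∑' γ : SAW.DomainSAW Ω' δ a b, x ^ γ.length) / ∑' γ : SAW.DomainSAW Ω δ a b, x ^ γ.length := by
  simp [ratio, vacZ_zero_left, twoLegZ_zero_left]

/-- `b(0) = 5/8`. -/
theorem dilExp_zero : dilExp 0 = 5 / 8 := by
  have hπ : Real.pi ≠ 0 := Real.pi_ne_zero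
  simp only [dilExp, neg_zero, zero_div, Real.arccos_zero]
  field_simp
  ring

/-- `b(1) = 1/2` (the Ising value; sanity check of the parametrisation). -/
example : dilExp 1 = 1 / 2 := by
  have hπ : Real.pi ≠ 0 := Real.pi_ne_zero
  have h₀ : Real.arccos (1 / 2) = Real.pi / 3 :=
    Real.arccos_eq_of_eq_cos (by positivity) (by linarith [Real.pi_pos])
      (by rw [Real.cos_pi_div_three])
  have h : Real.arccos (-1 / 2) = 2 * Real.pi / 3 := by
    rw [show (-1 / 2 : ℝ) = -(1 / 2) by ring, Real.arccos_neg, h₀]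
    ring
  simp only [dilExp, h]
  field_simp
  ring

/-- **The conformal germ of the card (G2) is `b'(0)`**: `dilExp` has derivative `−3/(8π)` at
`n = 0` — the number `b'(0) = (db/dκ)/(dn/dκ)|_{κ=8/3} = (−27/64)/(9π/8)` proved as
`cornerGerm_slope` in SketchIdeator1; so under stubs 3–5 the predicted limit of
`∂ₙ log R_δ(n; D, D')|₀` (the differenced compensated contact expectation) is `−(3/8π)·log d`. -/
theorem hasDerivAt_dilExp_zero : HasDerivAt dilExp (-(3 / (8 * Real.pi))) 0 := by
  have h1 : HasDerivAt (fun n : ℝ => -n / 2) (-1 / 2) 0 := by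
    simpa using ((hasDerivAt_id (0 : ℝ)).neg.div_const 2)
  have hx1 : (fun n : ℝ => -n / 2) 0 ≠ -1 := by norm_num
  have hx2 : (fun n : ℝ => -n / 2) 0 ≠ 1 := by norm_num
  have h3 := (Real.hasDerivAt_arccos hx1 hx2).comp 0 h1
  have h4 := (h3.const_mul (3 / (4 * Real.pi))).const_sub 1
  have hfun : dilExp = fun y => 1 - 3 / (4 * Real.pi) * (Real.arccos ∘ fun n : ℝ => -n / 2) y := by
    funext y
    simp [dilExp, Function.comp]
  rw [hfun]
  refine h4.congr_deriv ?_
  have hπ : Real.pi ≠ 0 := Real.pi_ne_zero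
  have hs : Real.sqrt (1 - ((fun n : ℝ => -n / 2) 0) ^ 2) = 1 := by norm_num
  rw [hs]
  field_simp
  ring

/-- `n ↦ d^{b(n)}` is continuous at `n = 0` with value `d^(5/8)` (for every real `d`, since
`b(0) = 5/8 ≠ 0`). -/
theorem tendsto_rpow_dilExp (d : ℝ) :
    Tendsto (fun n : ℝ => d ^ dilExp n) (𝓝[>] 0) (𝓝 (d ^ ((5 : ℝ) / 8))) := by
  have hcont : Continuous dilExp := by
    unfold dilExp
    fun_prop
  have h1 : ContinuousAt (fun t : ℝ => d ^ t) (dilExp 0) := by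
    apply Real.continuousAt_const_rpow'
    rw [dilExp_zero]; norm_num
  have h2 : ContinuousAt (fun n : ℝ => d ^ dilExp n) 0 := ContinuousAt.comp h1 hcont.continuousAt
  have h3 : Tendsto (fun n : ℝ => d ^ dilExp n) (𝓝 0) (𝓝 (d ^ dilExp 0)) := h2
  rw [dilExp_zero] at h3
  exact h3.mono_left nhdsWithin_le_nhds

/-- The pushed-forward SAW law gives mass at most `1` to every event (it is the zero measure or a
probability measure).  Verbatim the landed `Negative.map_law_apply_le_one`
(AvoidanceLimitExponentRigidity.lean), re-proved here because that module is not yet built on the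
farm snapshot. [folklore] -/
theorem map_law_apply_le_one (Ω : Set ℂ) (δ : ℝ) (a b : Site 2) (s : Set (CurveClass ℂ)) :
    (SAW.law Ω δ a b).map (fun γ ↦ γ.curve) s ≤ 1 := by
  have htot : SAW.law Ω δ a b univ ≤ 1 := by
    rw [SAW.law, Measure.smul_apply, smul_eq_mul]
    rcases eq_or_ne (SAW.weight Ω δ a b univ) 0 with h0 | h0
    · rw [h0]; simp
    rcases eq_or_ne (SAW.weight Ω δ a b univ) ⊤ with ht | ht
    · rw [ht]; simp
    · rw [ENNReal.inv_mul_cancel h0 ht]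
  calc (SAW.law Ω δ a b).map (fun γ ↦ γ.curve) s
      ≤ (SAW.law Ω δ a b).map (fun γ ↦ γ.curve) univ := measure_mono (subset_univ _)
    _ = SAW.law Ω δ a b univ := by
        rw [Measure.map_apply (SAW.DomainSAW.measurable_of_top _) MeasurableSet.univ, preimage_univ]
    _ ≤ 1 := htot

/-! ### The statements of the line -/

/-- STUB 1 statement — **the SAW point is the `n = 0` end of the critical line**:
`x_c(0) = 1/μ`.  Content: (i) for `y < x_c` the box two-leg generating function
`Σ_γ y^{|γ|}` (walks of length `≥ 2L − 2`) is massive by submultiplicativity `c_{m+k} ≤ c_m c_k`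
(Hammersley); (ii) at `y = x_c` it is NOT massive: `Σ_L B_L(x_c) = ∞` for bridges by span
(Hammersley–Welsh: otherwise `C(x_c) < ∞`, against `c_N ≥ μ^N`) plus confinement of span-`L`
bridges to the box at subexponential cost (DKY-type unfolding, `DKY2014_lem5` in the tree).
Pure SAW, size M–L. -/
def CriticalLineAtZero : Prop := critLine 0 = SAW.criticalFugacity

/-- STUB 2 statement — **corner identification** (the lattice meaning of the crux, route text
"`Z_0(Ω'_δ; a,b)/Z_0(Ω_δ; a,b)` up to walks touching `∂D' ∩ D` … largest-component bookkeeping"):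
under the crux's frame, `P_δ(range γ ⊆ closure D') − Z_{x_c}(Ω'_δ; a_δ,b_δ)/Z_{x_c}(Ω_δ; a_δ,b_δ) → 0`.
Content: eventually `a_δ, b_δ` lie in the largest component `Ω'_δ` and are joined there (Jordan
domains are uniformly locally connected; ε-ball agreement), so `IsEndpointApprox D' a b` holds and
every `Ω'_δ`-walk is an `Ω_δ`-walk with range in `closure D'`; `SAW.law` is a probability measure
by `IsEndpointApprox.reachable` (cf. `avoidanceLimit_false_without_reachable`); the excess event
"range in `closure D'` but not an `Ω'_δ`-walk" forces a visit to a mesh point of `∂D' ∩ D`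
(boundary touching without crossing), whose probability must be shown `o(1)` — a no-boundary-
crawling estimate for the critical SAW (expected `O(δ)`: boundary two-leg exponent `2 > 1`).
Size M–L; the last clause is the genuinely open part. -/
def CornerIdentification : Prop :=
  ∀ (D D' : DobrushinDomain) (a b : ℝ → Site 2), SAW.IsEndpointApprox D a b →
    D'.carrier ⊆ D.carrier → D'.pt 0 = D.pt 0 → D'.pt 1 = D.pt 1 →
    (∃ ε : ℝ, 0 < ε ∧ D'.carrier ∩ Metric.ball (D.pt 0) ε = D.carrier ∩ Metric.ball (D.pt 0) ε ∧
      D'.carrier ∩ Metric.ball (D.pt 1) ε = D.carrier ∩ Metric.ball (D.pt 1) ε) →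
    Tendsto (fun δ => (avoidProb D D' a b δ).toReal - sawRatio D D' a b δ) (𝓝[>] 0) (𝓝 0)

/-- STUB 3 statement — **THE LEVER: δ-uniform Lipschitz bound at the SAW corner.**  Along the
critical line of the strictly dilute family, `n ↦ R_δ(n; D, D')` is Lipschitz at `n = 0⁺` with a
constant independent of the mesh: `∃ n₀ > 0, C, ∀ᶠ δ → 0⁺, ∀ n ∈ [0, n₀],
|R_δ(n) − R_δ(0)| ≤ C·n`.  Mechanism (card `saw-corner-germ`, G1; = ideator 3's
`LinearResponseFinite` at `n = 0`): at finite volume `R_δ` is smooth in `n` and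
`∂ₙ log R_δ(n)|₀ = E^{SAW}_{Ω_δ}[K] − E^{SAW}_{Ω'_δ}[K]`, `K(γ) = M_hit(γ) − ℓ|γ|`, where
`M_hit(γ)` is the `x_c`-mass of self-avoiding polygons of the domain graph meeting `γ`
(minus the first `n`-derivative of `loopZ (Ω_δ ∖ γ)/loopZ Ω_δ`) and `ℓ = x_c'(0)/x_c` comes from
moving along the critical line; the single-domain expectations diverge (`E|γ| ≍ δ^{-4/3}`,
endpoint boxes), the DIFFERENCE stays bounded iff `ℓ` equals the bulk contact density `ℓ*`
("the fugacity rises exactly to pay for the polygons the walk forbids": `critLine'(0) = x_c ℓ*`)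
and the corrections to scaling of the SAW occupation measure along the curve have exponents
`> 4/3` (triage r1-2: all known ones do: `x_T = 2`, `x₄ − x₂ = 9/4`, `Δ₁/ν = 2`).  This is the
real-interval form asked for by triage r1-1 (sharpen 2): no complex `n` is needed.  Open; L–XL.
Falsifier: Monte-Carlo drift of the differenced compensated contact functional (card (1)). -/
def CornerLipschitz : Prop :=
  ∀ (D D' : DobrushinDomain) (a b : ℝ → Site 2), SAW.IsEndpointApprox D a b →
    D'.carrier ⊆ D.carrier → D'.pt 0 = D.pt 0 → D'.pt 1 = D.pt 1 →
    (∃ ε : ℝ, 0 < ε ∧ D'.carrier ∩ Metric.ball (D.pt 0) ε = D.carrier ∩ Metric.ball (D.pt 0) ε ∧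
      D'.carrier ∩ Metric.ball (D.pt 1) ε = D.carrier ∩ Metric.ball (D.pt 1) ε) →
    ∃ n₀ : ℝ, 0 < n₀ ∧ ∃ C : ℝ, ∀ᶠ δ in 𝓝[>] (0 : ℝ), ∀ n ∈ Set.Icc 0 n₀,
      |lineRatio D D' a b δ n - lineRatio D D' a b δ 0| ≤ C * n

/-- STUB 4 statement — **positive-fugacity limits exist**: for every small `n > 0` the critical
two-leg ratio `R_δ(n; D, D')` of the strictly dilute loop-dressed SAW converges as `δ → 0⁺`.
This is the convergence half of the route's `FugacityAnalyticity` (stmt-CriticalPhenomena-5063: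
δ-uniform analyticity / local boundedness in `n` + Vitali; equivalently card `continue-the-defect`'s
`UniformBound` + a window), restricted to REAL `n ∈ (0, n₀]` and with no value claimed, on the
strictly dilute path `w ≡ 0` (transported from the route's diagonal `w = n/2` at fixed small
`n > 0` by one osculation-irrelevance step, see the module docstring).  Open; XL. -/
def PositiveFugacityLimits : Prop :=
  ∀ (D D' : DobrushinDomain) (a b : ℝ → Site 2), SAW.IsEndpointApprox D a b →
    D'.carrier ⊆ D.carrier → D'.pt 0 = D.pt 0 → D'.pt 1 = D.pt 1 →
    (∃ ε : ℝ, 0 < ε ∧ D'.carrier ∩ Metric.ball (D.pt 0) ε = D.carrier ∩ Metric.ball (D.pt 0) ε ∧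
      D'.carrier ∩ Metric.ball (D.pt 1) ε = D.carrier ∩ Metric.ball (D.pt 1) ε) →
    ∃ n₀ : ℝ, 0 < n₀ ∧ ∀ n ∈ Set.Ioc 0 n₀, ∃ v : ℝ,
      Tendsto (fun δ => lineRatio D D' a b δ n) (𝓝[>] 0) (𝓝 v)

/-- STUB 5 statement — **Coulomb-gas values at positive fugacity**: whenever the limits
`v(n) = lim_δ R_δ(n; D, D')` exist on some `(0, n₀]`, they are GIVEN, for all small `n > 0`, by
the restriction form with the dilute exponent: `v(n) = Φ'_A(0)^{b(n)}`, `b = dilExp`.  This is what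
the route's `IsingWindow` (stmt-CriticalPhenomena-5080: closed form `b(n)` on `(1 − ε₀, 1]`)
followed by the identity theorem along `FugacityAnalyticity`'s neighbourhood of `(0, 1]` (NOT of
`0`) delivers — the conformal covariance and the VALUE enter the line only here, and only at
positive `n`.  CFT reading: `Z_n(Ω_δ;a,b)/Z_n(Ω_δ)` is the two-point function of the boundary
one-leg primary of weight `b(n) = h_{1,2}(κ(n))` in `(D; a, b)`; mapping `D → ℍ` by `φ⁻¹` and
`ℍ ∖ A → ℍ` by `Φ_A` (fixing `0`, `Φ_A(z) ∼ z` at `∞`) multiplies it by `|Φ_A'(0)|^{b(n)} · 1`, the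
lattice endpoint factors cancelling between `D` and `D'` by the ball agreement — so the value
`d^{b(n)}` needs exactly the restriction data of the crux, and the stub keeps every load-bearing
hypothesis (`avoidanceLimit_false_without_chordal / _normalisation / _deriv / _hullEq`).  It is the
ONLY stub that singles out a number (exponent rigidity, `avoidanceLimit_not_exp`).  Open; XL.
Falsifier: strip transfer matrices of the family at `n = 0.25, 0.5` reading `b(n)` (route's job). -/
def CoulombGasValues : Prop :=
  ∀ (D D' : DobrushinDomain) (a b : ℝ → Site 2), SAW.IsEndpointApprox D a b →
    D'.carrier ⊆ D.carrier → D'.pt 0 = D.pt 0 → D'.pt 1 = D.pt 1 →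
    (∃ ε : ℝ, 0 < ε ∧ D'.carrier ∩ Metric.ball (D.pt 0) ε = D.carrier ∩ Metric.ball (D.pt 0) ε ∧
      D'.carrier ∩ Metric.ball (D.pt 1) ε = D.carrier ∩ Metric.ball (D.pt 1) ε) →
    ∀ (φ : ConformalEquiv UpperHalfPlane.upperHalfPlaneSet D.carrier), D.IsChordalUniformizing φ →
    ∀ (A : Set ℂ), A = closure (UpperHalfPlane.upperHalfPlaneSet \
      {z | z ∈ UpperHalfPlane.upperHalfPlaneSet ∧ φ z ∈ D'.carrier}) →
    ∀ (Φ : ConformalEquiv (UpperHalfPlane.upperHalfPlaneSet \ A) UpperHalfPlane.upperHalfPlaneSet)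
      (d : ℝ), IsRestrictionMap A Φ → HasRestrictionDeriv A Φ d →
    ∀ (n₀ : ℝ) (v : ℝ → ℝ), 0 < n₀ →
      (∀ n ∈ Set.Ioc 0 n₀, Tendsto (fun δ => lineRatio D D' a b δ n) (𝓝[>] 0) (𝓝 (v n))) →
      ∀ᶠ n in 𝓝[>] (0 : ℝ), v n = d ^ dilExp n

/-! ### The registered stubs -/

/-- STUB 1 (M–L, pure SAW, provable with Hammersley–Welsh technology): `x_c(0) = 1/μ`. -/
theorem stub_criticalLineAtZero : CriticalLineAtZero := by
  sorry

/-- STUB 2 (M–L, lattice bookkeeping + no boundary crawling): the avoidance probability is the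
generating-function ratio up to `o(1)`. -/
theorem stub_cornerIdentification : CornerIdentification := by
  sorry

/-- STUB 3 (L–XL, THE LEVER, hardest stub OF THIS LINE): δ-uniform Lipschitz bound at the corner. -/
theorem stub_cornerLipschitz : CornerLipschitz := by
  sorry

/-- STUB 4 (XL, route debt: convergence half of FugacityAnalyticity on real `n > 0`). -/
theorem stub_positiveFugacityLimits : PositiveFugacityLimits := by
  sorry

/-- STUB 5 (XL, route debt: IsingWindow's closed form transported to small positive `n`). -/
theorem stub_coulombGasValues : CoulombGasValues := by
  sorry

/-! ### Name-keyed aliases (the skeleton audit admits a hypothesis of the composition only if its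
head constant is a registered obligation or is named like a declared stub) -/
namespace Registered

/-- Alias of `CriticalLineAtZero` keyed by the registered stub name. -/
abbrev stub_criticalLineAtZero : Prop := CriticalLineAtZero
/-- Alias of `CornerIdentification` keyed by the registered stub name. -/
abbrev stub_cornerIdentification : Prop := CornerIdentification
/-- Alias of `CornerLipschitz` keyed by the registered stub name. -/
abbrev stub_cornerLipschitz : Prop := CornerLipschitz
/-- Alias of `PositiveFugacityLimits` keyed by the registered stub name. -/
abbrev stub_positiveFugacityLimits : Prop := PositiveFugacityLimits
/-- Alias of `CoulombGasValues` keyed by the registered stub name. -/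
abbrev stub_coulombGasValues : Prop := CoulombGasValues

end Registered

/-! ### The composition (PROVED): the five stubs give the crux BY NAME -/

/-- **Commutation of limits at the corner.** From STUB 3 (uniform Lipschitz), STUB 4 (limits at
positive `n`) and STUB 5 (their closed form near `0⁺`): `R_δ(0; D, D') → d^(5/8)` as `δ → 0⁺`. -/
theorem tendsto_lineRatio_zero (h3 : CornerLipschitz) (h4 : PositiveFugacityLimits)
    (h5 : CoulombGasValues)
    (D D' : DobrushinDomain) (a b : ℝ → Site 2) (hab : SAW.IsEndpointApprox D a b)
    (hsub : D'.carrier ⊆ D.carrier) (hp0 : D'.pt 0 = D.pt 0) (hp1 : D'.pt 1 = D.pt 1)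
    (hball : ∃ ε : ℝ, 0 < ε ∧
      D'.carrier ∩ Metric.ball (D.pt 0) ε = D.carrier ∩ Metric.ball (D.pt 0) ε ∧
      D'.carrier ∩ Metric.ball (D.pt 1) ε = D.carrier ∩ Metric.ball (D.pt 1) ε)
    (φ : ConformalEquiv UpperHalfPlane.upperHalfPlaneSet D.carrier) (hφ : D.IsChordalUniformizing φ)
    (A : Set ℂ) (hA : A = closure (UpperHalfPlane.upperHalfPlaneSet \
      {z | z ∈ UpperHalfPlane.upperHalfPlaneSet ∧ φ z ∈ D'.carrier}))
    (Φ : ConformalEquiv (UpperHalfPlane.upperHalfPlaneSet \ A) UpperHalfPlane.upperHalfPlaneSet)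
    (d : ℝ) (hΦ : IsRestrictionMap A Φ) (hd : HasRestrictionDeriv A Φ d) :
    Tendsto (fun δ => lineRatio D D' a b δ 0) (𝓝[>] 0) (𝓝 (d ^ ((5 : ℝ) / 8))) := by
  obtain ⟨n₁, hn₁, C, hC⟩ := h3 D D' a b hab hsub hp0 hp1 hball
  obtain ⟨n₂, hn₂, hlim⟩ := h4 D D' a b hab hsub hp0 hp1 hball
  choose! v hv using hlim
  -- the closed form near `0⁺` and continuity of `n ↦ d^{b(n)}` give `v(n) → d^(5/8)`
  have hform : ∀ᶠ n in 𝓝[>] (0 : ℝ), v n = d ^ dilExp n :=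
    h5 D D' a b hab hsub hp0 hp1 hball φ hφ A hA Φ d hΦ hd n₂ v hn₂ hv
  have hval : Tendsto v (𝓝[>] 0) (𝓝 (d ^ ((5 : ℝ) / 8))) :=
    (tendsto_rpow_dilExp d).congr' (hform.mono fun n hn => hn.symm)
  -- ε/3 argument
  rw [Metric.tendsto_nhds]
  intro ε hε
  have hε3 : 0 < ε / 3 := by positivity
  have hC1 : 0 < |C| + 1 := by positivity
  have ev1 : ∀ᶠ n in 𝓝[>] (0 : ℝ), dist (v n) (d ^ ((5 : ℝ) / 8)) < ε / 3 :=
    Metric.tendsto_nhds.1 hval _ hε3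
  have ev2 : ∀ᶠ n in 𝓝[>] (0 : ℝ), n ∈ Set.Ioo 0 (min (min n₁ n₂) (ε / (3 * (|C| + 1)))) :=
    Ioo_mem_nhdsGT (lt_min (lt_min hn₁ hn₂) (by positivity))
  obtain ⟨n, hnv, hn0, hnlt⟩ := (ev1.and ev2).exists
  obtain ⟨hn12, hnε⟩ := lt_min_iff.1 hnlt
  obtain ⟨hnn₁, hnn₂⟩ := lt_min_iff.1 hn12
  have hCn : |C| * n < ε / 3 :=
    calc |C| * n ≤ (|C| + 1) * n := mul_le_mul_of_nonneg_right (by linarith) hn0.le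
      _ < (|C| + 1) * (ε / (3 * (|C| + 1))) := mul_lt_mul_of_pos_left hnε hC1
      _ = ε / 3 := by field_simp
  have evδ1 : ∀ᶠ δ in 𝓝[>] (0 : ℝ), dist (lineRatio D D' a b δ n) (v n) < ε / 3 :=
    Metric.tendsto_nhds.1 (hv n ⟨hn0, hnn₂.le⟩) _ hε3
  filter_upwards [hC, evδ1] with δ hδC hδ1
  have hδ2 : |lineRatio D D' a b δ n - lineRatio D D' a b δ 0| ≤ C * n := hδC n ⟨hn0.le, hnn₁.le⟩
  have hδ3 : |lineRatio D D' a b δ 0 - lineRatio D D' a b δ n| < ε / 3 := by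
    rw [abs_sub_comm]
    exact hδ2.trans_lt ((mul_le_mul_of_nonneg_right (le_abs_self C) hn0.le).trans_lt hCn)
  rw [Real.dist_eq] at hnv hδ1 ⊢
  calc |lineRatio D D' a b δ 0 - d ^ ((5 : ℝ) / 8)|
      = |(lineRatio D D' a b δ 0 - lineRatio D D' a b δ n) + (lineRatio D D' a b δ n - v n)
          + (v n - d ^ ((5 : ℝ) / 8))| := by ring_nf
    _ ≤ |lineRatio D D' a b δ 0 - lineRatio D D' a b δ n| + |lineRatio D D' a b δ n - v n|
          + |v n - d ^ ((5 : ℝ) / 8)| := abs_add_three _ _ _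
    _ < ε / 3 + ε / 3 + ε / 3 := by gcongr
    _ = ε := by ring

/-- **The composition.** STUBS 1–5 ⟹ the crux `AvoidanceLimit`, by name. -/
theorem AvoidanceLimit_of (h1 : Registered.stub_criticalLineAtZero)
    (h2 : Registered.stub_cornerIdentification) (h3 : Registered.stub_cornerLipschitz)
    (h4 : Registered.stub_positiveFugacityLimits) (h5 : Registered.stub_coulombGasValues) :
    Summit.CriticalPhenomena.SAWScalingLimit.Theses.SAWLoopFugacityFlow.AvoidanceLimit := by
  intro D D' a b hab hsub hp0 hp1 hball φ hφ A hA Φ d hΦ hd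
  -- (3)+(4)+(5): the limits commute at the corner
  have key : Tendsto (fun δ => lineRatio D D' a b δ 0) (𝓝[>] 0) (𝓝 (d ^ ((5 : ℝ) / 8))) :=
    tendsto_lineRatio_zero h3 h4 h5 D D' a b hab hsub hp0 hp1 hball φ hφ A hA Φ d hΦ hd
  -- (1): at `n = 0` the line ratio is the `x_c`-SAW generating-function ratio
  have hR0 : ∀ δ, lineRatio D D' a b δ 0 = sawRatio D D' a b δ := by
    intro δ
    have hc : critLine 0 = SAW.criticalFugacity := h1
    simp only [lineRatio, sawRatio, hc, ratio_zero_left]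
  -- (2): hence the avoidance probability (as a real) converges to `d^(5/8)`
  have h2' := h2 D D' a b hab hsub hp0 hp1 hball
  have hreal : Tendsto (fun δ => (avoidProb D D' a b δ).toReal) (𝓝[>] 0)
      (𝓝 (d ^ ((5 : ℝ) / 8))) := by
    have hsum := h2'.add key
    rw [zero_add] at hsum
    refine hsum.congr' (Eventually.of_forall fun δ => ?_)
    simp only [hR0]
    ring
  -- back to `ℝ≥0∞`: the avoidance probability is at most `1`, hence finite
  have hne : ∀ δ, avoidProb D D' a b δ ≠ ∞ := fun δ =>
    ne_top_of_le_ne_top ENNReal.one_ne_top (map_law_apply_le_one _ _ _ _ _)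
  have hfin : Tendsto (fun δ => ENNReal.ofReal ((avoidProb D D' a b δ).toReal)) (𝓝[>] 0)
      (𝓝 (ENNReal.ofReal (d ^ ((5 : ℝ) / 8)))) := ENNReal.tendsto_ofReal hreal
  have heq : (fun δ => ENNReal.ofReal ((avoidProb D D' a b δ).toReal)) = avoidProb D D' a b :=
    funext fun δ => ENNReal.ofReal_toReal (hne δ)
  rw [heq] at hfin
  exact hfin

/-- Wiring check: the registered stubs feed `AvoidanceLimit_of` as stated. -/
example : AvoidanceLimit :=
  AvoidanceLimit_of stub_criticalLineAtZero stub_cornerIdentification stub_cornerLipschitz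
    stub_positiveFugacityLimits stub_coulombGasValues

/-! ### Scratch checks against the landed `Negative/*` lemmas (built modules only) -/

/-- Landed: the chordal normalisation of `φ` is load-bearing — STUB 5 keeps it. -/
example : ¬ AvoidanceLimitWithoutChordal := avoidanceLimit_false_without_chordal

/-- Landed: reachability is load-bearing — STUB 2 is where `SAW.law` must be a probability
measure (with the far-site witness `sawRatio = 0/… ` and `avoidProb = 0`). -/
example : ¬ AvoidanceLimitWithoutReachable := avoidanceLimit_false_without_reachable

/-- Landed: the normalisation of `Φ` at `∞`, the derivative clause and the hull identification are
load-bearing — all three sit verbatim in STUB 5's frame, the only stub that sees `d`. -/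
example : ¬ AvoidanceLimitWithoutNormalisation ∧ ¬ AvoidanceLimitWithoutDeriv ∧
    ¬ AvoidanceLimitWithoutHullEq :=
  ⟨avoidanceLimit_false_without_normalisation, avoidanceLimit_false_without_deriv,
    avoidanceLimit_false_without_hullEq⟩

end Summit.CriticalPhenomena.SAWScalingLimit.Cruxes.AvoidanceLimit.SawCornerGerm

end
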